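import Literature.Analysis.FluidPDE.LocalTypeIWeakSerrinProofs
import Literature.Analysis.FluidPDE.LocalTypeICongr
import Literature.Analysis.FluidPDE.LocalTypeIScaling
import Literature.Analysis.FluidPDE.LeraySuitableWeakSolutions
import Literature.Analysis.FluidPDE.NSWeakStrongUniquenessHolds
import Literature.Analysis.FluidPDE.TaoLocalisationHolds
import Literature.Analysis.FluidPDE.TaoLocalisationProofs
import Literature.Analysis.FluidPDE.KatoMaximalTimeSingular
import Literature.Analysis.FluidPDE.SuitableWeakCongr
import Literature.Analysis.FluidPDE.NSSuitableESSProofs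
import Literature.Analysis.FluidPDE.ClassicalSuitable
import HarnessLib

/-!
# hnec for the energy-Type-I slab family: a Type-I blow-up obeys the pressure-free slab clause S₁′
# (crux `TypeIliouvilleNoTypeII`, stmt-NavierStokesRegularity-0056; §B keep/kill calibration)

Helper file (theorems only).  The §B cell closed the hard core `NoTypeII` in the kernel MODULO two
statements (ns-typeII-p1 `…EternalSplitPressureFree.lean`, ns-typeII-p2 `…EternalSplitModL.lean`,
`…ASlabModL.lean`): an a-priori clause on the blow-up side — S₁′ («for every maximal Leray–Hopf
solution from rapidly decaying data, Albritton–Barker's `A`, `C`, `E` of the viscosity-normalised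
field `ũ = timeRescale ν⁻¹ ν⁻¹ u` are bounded by a finite `I` on every parabolic ball of a final slab
`(S₁, νT) × ℝ³`»), or merely its `A`-part ASlab — and a Liouville statement on the eternal side (EEL′,
or KNSS's (L)).  Those files give the KILL direction `clause ∧ Liouville ⇒ NoTypeII`.  This file lands
the NECESSITY direction, unconditionally:

  **`pressureFreeSlab_of_isTypeIBlowup`: frame ∧ `IsTypeIBlowup u T` ⇒ S₁′-clause for `(ν, T, u, p)`,**

i.e. Albritton–Barker 2019, Lemma 2.5 with Remark 3.2 («the Type-I rate `(c_∞)` gives `𝐈 < ∞`») made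
UNIFORM IN THE CENTRE on a final slab (the printed per-ball statement, tree fact
`albrittonBarker2019_lemma_2_5_rate`, gives `𝐈(Q(z,R)) < ∞` ball by ball only).  Assembly from tree
parts: Leray's global weak continuation `v` of the datum with its Riesz pressure `q`
(`exists_isGlobalLerayHopf_and_isLocalEnergySolutionOn`), suitable on `(0, T+1) × ℝ³`,
`q ∈ L^{3/2}((0,T) × ℝ³)`, `v = u` a.e. on the strip by weak–strong uniqueness in Tao's strong class
(pattern of the tree's `stub_cknC_ceiling_of_isTypeIBlowup`); the rate interpolation
`C(Q) ≤ 4|B₁|^{1/4} C^{3/2} A(Q)^{3/4}` on EVERY ball of the rate slab (`cknC_le_of_rate_slab`: the unit-ball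
`AlbrittonBarker2019.cknC_le_of_rate` along the parabolic dilation `cknC_nsZoom`/`cknAEss_nsZoom`);
unit-scale data uniform in the centre (`A ≤ (2δ)⁻¹·2E₀` by the energy inequality, `D ≤ (2δ)⁻²‖q‖^{3/2}`);
Seregin's iteration with uniform constants (`AlbrittonBarker2019.uniform_bound_of_interp`) on the
`Opens` slab; back to `(u, ∇u)` by `cknAEss_congr_ae`/`cknC_congr_ae` and uniqueness of weak gradients.
This file stops at unit viscosity (`pressureFreeSlab_one_of_isTypeIBlowup`); general viscosity and the
by-name consequences (`NoTypeII ⇒ S₁′ ⇒ ASlab`; under EEL′ `NoTypeII ⇔ S₁′`; under (L)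
`NoTypeII ⇔ S₁′ ⇔ ASlab`) are in the companion `…PressureFreeSlabNecessaryIff.lean`.
READING for the §B critics (K2c): every energy-Type-I slab candidate (ASlab, S₁′, or any `A/C/E`
sub-clause) is a CONSEQUENCE of 0056 — weaker currency, legitimately «below the crux» — and is
EQUIVALENT to 0056 modulo the Liouville hard core; the registered stub 1 of `eternal_split`
(`𝐈 < ⊤` on a final slab, with the pressure term) contains S₁′ as its pressure-free part.
WHAT THIS IS NOT: not NS regularity; nothing here says S₁′ or ASlab holds a priori — they are OPEN,
exactly as open as `NoTypeII` modulo (L). [folklore]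

References: Albritton–Barker 2019 (arXiv:1811.00502) Def. 2.1, Lemmas 2.5–2.6, Remark 3.2;
Seregin 2006/2007 (critical Morrey estimates); Seregin–Šverák 2009 Lemma 3.5.
-/

noncomputable section

-- the summit and its single problem share the name `NavierStokesRegularity` (D-0017 nested layout)
set_option linter.dupNamespace false

open Set Function Filter Topology MeasureTheory Metric TopologicalSpace
open scoped NNReal ENNReal

namespace Summit.NavierStokesRegularity.NavierStokesRegularity.Theorems.TypeIliouvilleNoTypeII.SlabNecessary

open Literature.Analysis Literature.Analysis.FluidPDE
open Literature.Analysis.FluidPDE.AlbrittonBarker2019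

/-! ## Geometry of slab balls -/

/-- A parabolic ball `Q_ρ(z')` inside the slab `(a, b) × ℝ³` has its times in `(a, b)`:
`a ≤ t' - ρ²` and `t' ≤ b` (`z' = (t', x')`, `ρ > 0`). [folklore] -/
theorem margins_of_subset_slab {a b ρ : ℝ} {z' : ℝ × (EuclideanSpace ℝ (Fin 3))} (hρ : 0 < ρ)
    (hsub : parabolicCylinder ρ z' ⊆ Ioo a b ×ˢ univ) : a ≤ z'.1 - ρ ^ 2 ∧ z'.1 ≤ b := by
  have hne : (ball z'.2 ρ).Nonempty := ⟨z'.2, mem_ball_self hρ⟩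
  have hlt : z'.1 - ρ ^ 2 < z'.1 := by nlinarith
  have h1 : Ioo (z'.1 - ρ ^ 2) z'.1 ⊆ Ioo a b := by
    rcases prod_subset_prod_iff.1 hsub with h | h | h
    · exact h.1
    · exact absurd h (nonempty_Ioo.2 hlt).ne_empty
    · exact absurd h hne.ne_empty
  exact (Ioo_subset_Ioo_iff hlt).1 h1

/-! ## The rate interpolation on every ball of the rate slab (parabolic dilation to unit depth) -/

/-- **`C ≤ κ A^{3/4}` on every parabolic ball of the rate slab.**  If `u` is continuous on
`(t₂, T) × ℝ³` and obeys the Type-I rate `‖u(t, x)‖ ≤ C/√(T - t)` there (`C ≥ 0`), then for every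
parabolic ball `Q_ρ(z') ⊆ (t₂, T) × ℝ³`:
`C(Q_ρ(z')) ≤ 4 |B₁|^{1/4} C^{3/2} · A(Q_ρ(z'))^{3/4}` — the tree's unit-ball interpolation
`AlbrittonBarker2019.cknC_le_of_rate` transported along the parabolic dilation of ratio `√(T - t₂)`
centred at `(T, x')` (`cknC_nsZoom`, `cknAEss_nsZoom`), which maps the unit ball onto
`(t₂, T) × B_{√(T-t₂)}(x')` and preserves the rate. [cite: AlbrittonBarker2019, proof of Lemma 2.5 (arXiv:1811.00502 §2), rate case] -/
theorem cknC_le_of_rate_slab {u : ℝ → (EuclideanSpace ℝ (Fin 3)) → (EuclideanSpace ℝ (Fin 3))} {C t₂ T : ℝ} (hC : 0 ≤ C) (ht₂T : t₂ < T)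
    (hcont : ContinuousOn (uncurry u) (Ioo t₂ T ×ˢ univ))
    (hrate : ∀ t ∈ Ioo t₂ T, ∀ x, ‖u t x‖ ≤ C / Real.sqrt (T - t))
    {z' : ℝ × (EuclideanSpace ℝ (Fin 3))} {ρ : ℝ} (hρ : 0 < ρ) (hsub : parabolicCylinder ρ z' ⊆ Ioo t₂ T ×ˢ univ) :
    cknC ρ z' u ≤ (4 * volume (ball (0 : (EuclideanSpace ℝ (Fin 3))) 1) ^ (1 / 4 : ℝ) * ENNReal.ofReal (C ^ (3 / 2 : ℝ))) *
      cknAEss ρ z' u ^ (3 / 4 : ℝ) := by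
  obtain ⟨hm1, hm2⟩ := margins_of_subset_slab hρ hsub
  set d : ℝ := T - t₂ with hd
  have hd0 : 0 < d := by rw [hd]; linarith
  set c : ℝ := Real.sqrt d with hc
  have hc0 : 0 < c := Real.sqrt_pos.2 hd0
  have hc2 : c ^ 2 = d := Real.sq_sqrt hd0.le
  -- the dilated field and the preimage ball
  set w : ℝ → (EuclideanSpace ℝ (Fin 3)) → (EuclideanSpace ℝ (Fin 3)) := c • stPull (c ^ 2) c T z'.2 u with hw
  set ζ : ℝ × (EuclideanSpace ℝ (Fin 3)) := ((z'.1 - T) / c ^ 2, 0) with hζ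
  have hζ' : stAffine (c ^ 2) c T z'.2 ζ = z' := by
    rw [hζ, stAffine_apply, smul_zero, add_zero]
    ext <;> simp only
    field_simp
    ring
  have hρc : 0 < ρ / c := div_pos hρ hc0
  have hcρ : c * (ρ / c) = ρ := by field_simp
  have hCz : cknC ρ z' u = cknC (ρ / c) ζ w := by
    rw [hw, cknC_nsZoom hc0 hρc T z'.2 ζ u, hcρ, hζ']
  have hAz : cknAEss ρ z' u = cknAEss (ρ / c) ζ w := by
    rw [hw, cknAEss_nsZoom hc0 hρc T z'.2 ζ u, hcρ, hζ']
  rw [hCz, hAz]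
  -- the unit ball `Q((0,0), 1)` is mapped into the rate slab
  have hmap : ∀ s : ℝ, s ∈ Ioo (-1 : ℝ) 0 → T + c ^ 2 * s ∈ Ioo t₂ T := by
    intro s hs
    rw [hc2]
    constructor <;> nlinarith [hs.1, hs.2, hd0]
  refine cknC_le_of_rate (z := ((0 : ℝ), (0 : (EuclideanSpace ℝ (Fin 3))))) hC ?_ ?_ hρc ?_
  · -- measurability: `w` is continuous on the unit ball
    have hφ : Continuous fun q : ℝ × (EuclideanSpace ℝ (Fin 3)) => (T + c ^ 2 * q.1, z'.2 + c • q.2) := by fun_prop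
    have hmaps : MapsTo (fun q : ℝ × (EuclideanSpace ℝ (Fin 3)) => (T + c ^ 2 * q.1, z'.2 + c • q.2))
        (parabolicCylinder 1 ((0 : ℝ), (0 : (EuclideanSpace ℝ (Fin 3))))) (Ioo t₂ T ×ˢ univ) := by
      intro q hq
      rw [mem_parabolicCylinder] at hq
      refine ⟨hmap q.1 ⟨by linarith [hq.1.1], by linarith [hq.1.2]⟩, mem_univ _⟩
    have hwc : ContinuousOn (uncurry w) (parabolicCylinder 1 ((0 : ℝ), (0 : (EuclideanSpace ℝ (Fin 3))))) := by
      have h1 : uncurry w = fun q => c • uncurry u (T + c ^ 2 * q.1, z'.2 + c • q.2) := by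
        funext q; rfl
      rw [h1]
      exact ((hcont.comp hφ.continuousOn hmaps).const_smul c)
    exact hwc.aestronglyMeasurable (isOpen_parabolicCylinder _ _).measurableSet
  · -- the rate for `w` on the unit ball: `‖w(s, y)‖ = √d ‖u‖ ≤ √d C/√(-d s) = C/√(-s)`
    intro s y hsy
    rw [mem_parabolicCylinder] at hsy
    have hs : s ∈ Ioo (-1 : ℝ) 0 := ⟨by linarith [hsy.1.1], by linarith [hsy.1.2]⟩
    have hs0 : 0 < -s := by linarith [hs.2]
    have hphys := hmap s hs
    have hb := hrate _ hphys (z'.2 + c • y)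
    have hTs : T - (T + c ^ 2 * s) = d * (-s) := by rw [hc2]; ring
    rw [hTs, Real.sqrt_mul hd0.le, ← hc] at hb
    show ‖c • u (T + c ^ 2 * s) (z'.2 + c • y)‖ ≤ C / Real.sqrt ((0 : ℝ) - s)
    rw [norm_smul, Real.norm_of_nonneg hc0.le, zero_sub]
    have hsq : 0 < Real.sqrt (-s) := Real.sqrt_pos.2 hs0
    calc c * ‖u (T + c ^ 2 * s) (z'.2 + c • y)‖ ≤ c * (C / (c * Real.sqrt (-s))) :=
          mul_le_mul_of_nonneg_left hb hc0.le
      _ = C / Real.sqrt (-s) := by field_simp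
  · -- the preimage ball lies in the unit ball
    intro q hq
    rw [mem_parabolicCylinder] at hq ⊢
    have hρd : ρ ^ 2 ≤ d := by rw [hd]; linarith
    have hρc1 : ρ / c ≤ 1 := by
      rw [div_le_one hc0]
      calc ρ = Real.sqrt (ρ ^ 2) := (Real.sqrt_sq hρ.le).symm
        _ ≤ Real.sqrt d := Real.sqrt_le_sqrt hρd
    have hζ1 : ζ.1 = (z'.1 - T) / d := by rw [hζ, hc2]
    have hζ2 : ζ.2 = 0 := rfl
    rw [hζ1] at hq
    rw [hζ2] at hq
    refine ⟨⟨?_, ?_⟩, lt_of_lt_of_le hq.2 hρc1⟩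
    · -- `-1 < q.1`
      have h1 : (z'.1 - T) / d - (ρ / c) ^ 2 < q.1 := hq.1.1
      have h2 : -1 ≤ (z'.1 - T) / d - (ρ / c) ^ 2 := by
        rw [div_pow, hc2, ← sub_div, le_div_iff₀ hd0]
        rw [hd]; linarith
      simpa using h2.trans_lt h1
    · -- `q.1 < 0`
      have h1 : q.1 < (z'.1 - T) / d := hq.1.2
      have h2 : (z'.1 - T) / d ≤ 0 := div_nonpos_of_nonpos_of_nonneg (by linarith) hd0.le
      simpa using h1.trans_le h2

/-! ## Energy of the slices -/

/-- `∫ ‖u(t)‖² ≤ 2 E₀`, `E₀ = ½‖u(0)‖₂²`, for `t ∈ [0, T]` (energy inequality of the Leray–Hopf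
class from `s = 0`, zero force, dissipation dropped). [cite: Leray1934, (5.2)] -/
theorem lintegral_enorm_sq_le_twice_energy {ν T : ℝ} {u : ℝ → (EuclideanSpace ℝ (Fin 3)) → (EuclideanSpace ℝ (Fin 3))}
    (hLH : IsLerayHopfOn T ν 0 (u 0) u) (hν : 0 ≤ ν) {t : ℝ} (ht : t ∈ Icc 0 T) :
    ∫⁻ x, ‖u t x‖ₑ ^ 2 ≤ ENNReal.ofReal (2 * VectorCalculus.kineticEnergy (u 0)) := by
  obtain ⟨G, -, hE⟩ := hLH.energy_ineq_zero
  have h := hE t ht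
  simp only [Pi.zero_apply, inner_zero_left, integral_zero, intervalIntegral.integral_zero,
    add_zero] at h
  have hD : 0 ≤ ν * (∫⁻ τ in Ioo 0 t, ∫⁻ x, ENNReal.ofReal (frobeniusNormSq (G τ x))).toReal :=
    mul_nonneg hν ENNReal.toReal_nonneg
  have hK : VectorCalculus.kineticEnergy (u t) ≤ VectorCalculus.kineticEnergy (u 0) := by linarith
  have heq : ∫⁻ x, ‖u t x‖ₑ ^ 2 = ENNReal.ofReal (2 * VectorCalculus.kineticEnergy (u t)) :=
    eEnergy_eq_ofReal (u t) (hLH.memLp t ht)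
  rw [heq]
  exact ENNReal.ofReal_le_ofReal (by linarith)

/-- `A(u; Q_ρ(z')) ≤ ρ⁻¹ · 2E₀` for every parabolic ball with times in `[0, T]`. [folklore] -/
theorem cknAEss_le_of_energy {ν T : ℝ} {u : ℝ → (EuclideanSpace ℝ (Fin 3)) → (EuclideanSpace ℝ (Fin 3))}
    (hLH : IsLerayHopfOn T ν 0 (u 0) u) (hν : 0 ≤ ν) {ρ : ℝ} {z' : ℝ × (EuclideanSpace ℝ (Fin 3))}
    (htimes : Ioo (z'.1 - ρ ^ 2) z'.1 ⊆ Icc 0 T) :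
    cknAEss ρ z' u ≤ (ENNReal.ofReal ρ)⁻¹ * ENNReal.ofReal (2 * VectorCalculus.kineticEnergy (u 0)) := by
  unfold cknAEss
  refine essSup_le_of_ae_le _ ?_
  filter_upwards [ae_restrict_mem measurableSet_Ioo] with t ht
  exact mul_le_mul' le_rfl ((lintegral_mono_set (subset_univ _)).trans
    (le_of_eq_of_le (Measure.restrict_univ ▸ rfl) (lintegral_enorm_sq_le_twice_energy hLH hν (htimes ht))))

/-! ## The core theorem at unit viscosity -/

/-- **Albritton–Barker's Lemma 2.5 (rate case), UNIFORM IN THE CENTRE on a final slab.**  Let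
`(u, p)` be a classical solution of the unit-viscosity unforced Navier–Stokes system on
`ℝ³ × [0, T)`, Leray–Hopf from the rapidly decaying datum `u 0`, blowing up at most at the Type-I
rate at `T` (`IsTypeIBlowup u T`: `‖u(t, x)‖ ≤ C/√(T - t)` near `T`).  Then there are `S₁ < T` and a
finite `I` with `A(u; Q) ≤ I`, `C(u; Q) ≤ I` and `E(∇u; Q) ≤ I` for EVERY parabolic ball
`Q = Q_r(z) ⊆ (S₁, T) × ℝ³` — the pressure-free energy-Type-I slab clause S₁′ of the line
`eternal_split` (ns-typeII-p1's `EternalSplit.isTypeIBlowup_of_pressureFreeSlab_of_eternalLiouville`,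
hypotheses `hA hC hE` at `ν = 1`).
Proof.  Leray's global weak continuation `v` of the datum with its Riesz pressure `q` is suitable on
`(0, T+1) × ℝ³`, `q ∈ L^{3/2}` of the strip `(0, T) × ℝ³`, and `v = u` a.e. on the strip
(weak–strong uniqueness in Tao's strong class) — exactly as in the tree's
`stub_cknC_ceiling_of_isTypeIBlowup`; the rate interpolation `C ≤ κ A^{3/4}` holds on every ball of
the rate slab (`cknC_le_of_rate_slab`); the unit-scale data `A ≤ (2δ)⁻¹ 2E₀`, `D ≤ (2δ)⁻² ‖q‖^{3/2}`
at the starting radius `2δ = √(T - t₂)/2` are uniform in the centre; Seregin's iteration with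
constants uniform in the centre (`AlbrittonBarker2019.uniform_bound_of_interp`) bounds
`A + E + C + D ≤ K` on every ball of radius `≤ δ` of the slab `(T - δ², T) × ℝ³`; finally `v ↦ u` by
a.e. invariance of `A`, `C` and uniqueness of weak gradients (`E(G) = E(∇u)`).
[cite: AlbrittonBarker2019, Lemma 2.5 and Remark 3.2 (arXiv:1811.00502 §2–§3)] -/
theorem pressureFreeSlab_one_of_isTypeIBlowup {T : ℝ} (hT : 0 < T) {u : ℝ → (EuclideanSpace ℝ (Fin 3)) → (EuclideanSpace ℝ (Fin 3))}
    {p : ℝ → (EuclideanSpace ℝ (Fin 3)) → ℝ} (hcl : IsClassicalNSSolutionOn (Ico 0 T) 1 0 u p)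
    (hLH : IsLerayHopfOn T 1 0 (u 0) u) (hdec : HasRapidSpatialDecay (u 0))
    (hTI : IsTypeIBlowup u T) :
    ∃ S₁ : ℝ, S₁ < T ∧ ∃ I : ℝ≥0∞, I ≠ ⊤ ∧
      ∀ r : ℝ, 0 < r → ∀ z : ℝ × (EuclideanSpace ℝ (Fin 3)), parabolicCylinder r z ⊆ Ioo S₁ T ×ˢ univ →
        cknAEss r z u ≤ I ∧ cknC r z u ≤ I ∧ cknE r z (fun s y => fderiv ℝ (u s) y) ≤ I := by
  -- ### the Leray continuation: a global suitable Leray–Hopf solution from `u 0`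
  have hu0 : MemLp (u 0) 2 volume := hLH.memLp 0 ⟨le_rfl, hT.le⟩
  have hdiv : IsWeaklyDivFree (u 0) := hLH.isWeaklyDivFree_datum hT
  obtain ⟨v, q, hGL, -, hvmeas, -, hq32, -, hLE⟩ :=
    exists_isGlobalLerayHopf_and_isLocalEnergySolutionOn (zero_lt_one : (0 : ℝ) < 1) hu0 hdiv
  -- ### weak–strong uniqueness on `[0, T']`, `T' < T`: `v(t) = u(t)` a.e. for `0 < t < T`
  have hslice : ∀ t ∈ Ioo 0 T, v t =ᵐ[volume] u t := by
    intro t ht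
    have hT' : (t + T) / 2 ∈ Ioo 0 T := ⟨by linarith [ht.1], by linarith [ht.2]⟩
    have hS : MemLqLp ⊤ ⊤ u (Ioo 0 ((t + T) / 2)) :=
      tao2011_hasBoundedSobolevNormsOn.memLqLp_top tao2011_hasBoundedSobolevNormsOn_holds
        linfty_bound_of_hasBoundedSobolevNormsOn_holds 1 T zero_lt_one hT u p hcl hLH hdec _ hT'
    have hu' : IsLerayHopfOn ((t + T) / 2) 1 0 (u 0) u := hLH.of_le hT'.2.le
    have hv' : IsLerayHopfOn ((t + T) / 2) 1 0 (u 0) v := hGL _ hT'.1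
    have h3 : (3 : ℝ≥0∞) < ⊤ := ENNReal.ofNat_lt_top
    have hqr : 2 / (⊤ : ℝ≥0∞) + 3 / (⊤ : ℝ≥0∞) ≤ 1 := by simp
    exact weak_strong_uniqueness_holds zero_lt_one hT'.1 hu' h3 hqr hS hv' t
      ⟨ht.1, by linarith [ht.2]⟩
  -- ### space–time a.e. equality on the strip `(0, T) × ℝ³`
  have hcontIco : ContinuousOn (uncurry u) (Ico 0 T ×ˢ (univ : Set (EuclideanSpace ℝ (Fin 3)))) :=
    hcl.smooth_velocity.continuousOn
  have hcont : ContinuousOn (uncurry u) (Ioo 0 T ×ˢ (univ : Set (EuclideanSpace ℝ (Fin 3)))) :=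
    hcontIco.mono (Set.prod_mono Ioo_subset_Ico_self Subset.rfl)
  have humeas : AEStronglyMeasurable (uncurry u) (volume.restrict (Ioo 0 T ×ˢ (univ : Set (EuclideanSpace ℝ (Fin 3))))) :=
    hcont.aestronglyMeasurable (measurableSet_Ioo.prod MeasurableSet.univ)
  have hvmeas' : AEStronglyMeasurable (uncurry v) (volume.restrict (Ioo 0 T ×ˢ (univ : Set (EuclideanSpace ℝ (Fin 3))))) := by
    have e : ((volume : Measure ℝ).restrict (Ioi 0)).prod (volume : Measure (EuclideanSpace ℝ (Fin 3))) =
        volume.restrict (Ioi (0 : ℝ) ×ˢ (univ : Set (EuclideanSpace ℝ (Fin 3)))) := by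
      rw [Measure.volume_eq_prod, ← Measure.restrict_univ (μ := (volume : Measure (EuclideanSpace ℝ (Fin 3)))),
        Measure.prod_restrict, Measure.restrict_univ]
    rw [e] at hvmeas
    exact hvmeas.mono_measure
      (Measure.restrict_mono (Set.prod_mono Ioo_subset_Ioi_self Subset.rfl) le_rfl)
  have hae : uncurry v =ᵐ[volume.restrict (Ioo 0 T ×ˢ (univ : Set (EuclideanSpace ℝ (Fin 3))))] uncurry u :=
    ae_restrict_prod_of_forall_ae_eq hslice hvmeas' humeas
  have haeQ : ∀ {r : ℝ} {z : ℝ × (EuclideanSpace ℝ (Fin 3))}, parabolicCylinder r z ⊆ Ioo 0 T ×ˢ (univ : Set (EuclideanSpace ℝ (Fin 3))) →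
      ∀ᵐ w ∂(volume.restrict (parabolicCylinder r z)), uncurry v w = uncurry u w :=
    fun hsub => ae_restrict_of_ae_restrict_of_subset hsub hae
  -- ### suitability of `(v, q)` on `(0, T+1) × ℝ³`, its weak gradient
  have hsw : IsSuitableWeakSolutionOn (slab (EuclideanSpace ℝ (Fin 3)) (Ioo 0 (T + 1)) isOpen_Ioo) 1 0 v q :=
    (hLE (T + 1) (by linarith)).suitable
  obtain ⟨G, hGw, -, -⟩ := hsw.localEnergy
  -- ### the rate on `(t₁, T)`; `t₂ = max t₁ 0`, `d = T - t₂`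
  obtain ⟨C, hC⟩ := hTI
  obtain ⟨t₁, ht₁T, ht₁⟩ :
      ∃ t₁ : ℝ, t₁ < T ∧ ∀ t ∈ Ioo t₁ T, ∀ x, ‖u t x‖ ≤ C / Real.sqrt (T - t) := by
    obtain ⟨l, hl, hsub⟩ := mem_nhdsLT_iff_exists_Ioo_subset.1 hC
    exact ⟨l, hl, fun t ht => hsub ht⟩
  set t₂ : ℝ := max t₁ 0 with ht₂
  have ht₂T : t₂ < T := max_lt ht₁T hT
  have ht₂0 : 0 ≤ t₂ := le_max_right _ _
  set d : ℝ := T - t₂ with hd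
  have hd0 : 0 < d := by rw [hd]; linarith
  have hrate' : ∀ t ∈ Ioo t₂ T, ∀ x, ‖u t x‖ ≤ |C| / Real.sqrt (T - t) := fun t ht x =>
    (ht₁ t ⟨(le_max_left _ _).trans_lt ht.1, ht.2⟩ x).trans
      (div_le_div_of_nonneg_right (le_abs_self C) (Real.sqrt_nonneg _))
  have hstrip₂ : Ioo t₂ T ×ˢ (univ : Set (EuclideanSpace ℝ (Fin 3))) ⊆ Ioo 0 T ×ˢ univ :=
    Set.prod_mono (Ioo_subset_Ioo_left ht₂0) Subset.rfl
  -- ### the rate slab as an `Opens`, suitability and weak gradient there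
  set Q : Opens (ℝ × (EuclideanSpace ℝ (Fin 3))) := slab (EuclideanSpace ℝ (Fin 3)) (Ioo t₂ T) isOpen_Ioo with hQdef
  have hQ : (Q : Set (ℝ × (EuclideanSpace ℝ (Fin 3)))) = Ioo t₂ T ×ˢ univ := rfl
  have hQle : Q ≤ slab (EuclideanSpace ℝ (Fin 3)) (Ioo 0 (T + 1)) isOpen_Ioo :=
    slab_mono (fun t ht => ⟨ht₂0.trans_lt ht.1, by linarith [ht.2]⟩)
  have hswQ : IsSuitableWeakSolutionOn Q 1 0 v q := hsw.of_le hQle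
  have hGQ : HasWeakSpatialGradientOn Q v G := hGw.mono hQle
  -- ### the interpolation `C ≤ κ A^{3/4}` on every ball of `Q`, for `v`
  set κ : ℝ≥0∞ := 4 * volume (ball (0 : (EuclideanSpace ℝ (Fin 3))) 1) ^ (1 / 4 : ℝ) * ENNReal.ofReal (|C| ^ (3 / 2 : ℝ))
    with hκ
  have hκtop : κ ≠ ∞ := ENNReal.mul_ne_top (ENNReal.mul_ne_top ENNReal.ofNat_ne_top
    (ENNReal.rpow_ne_top_of_nonneg (by norm_num) measure_ball_lt_top.ne)) ENNReal.ofReal_ne_top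
  have hcont₂ : ContinuousOn (uncurry u) (Ioo t₂ T ×ˢ (univ : Set (EuclideanSpace ℝ (Fin 3)))) := hcont.mono hstrip₂
  have hinterp : ∀ (z' : ℝ × (EuclideanSpace ℝ (Fin 3))) (ρ : ℝ), 0 < ρ → parabolicCylinder ρ z' ⊆ (Q : Set (ℝ × (EuclideanSpace ℝ (Fin 3)))) →
      cknC ρ z' v ≤ κ * cknAEss ρ z' v ^ (3 / 4 : ℝ) := by
    intro z' ρ hρ hsub
    rw [hQ] at hsub
    rw [cknC_congr_ae (haeQ (hsub.trans hstrip₂)), cknAEss_congr_ae (haeQ (hsub.trans hstrip₂))]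
    exact cknC_le_of_rate_slab (abs_nonneg C) ht₂T hcont₂ hrate' hρ hsub
  -- ### unit-scale data at the starting radius `2δ`, `δ = √d/4`
  set δ : ℝ := Real.sqrt d / 4 with hδ
  have hδ0 : 0 < δ := div_pos (Real.sqrt_pos.2 hd0) four_pos
  have hδsq : δ ^ 2 = d / 16 := by rw [hδ, div_pow, Real.sq_sqrt hd0.le]; norm_num
  have h2δsq : (2 * δ) ^ 2 = d / 4 := by rw [mul_pow, hδsq]; ring
  set A₀ : ℝ≥0∞ := (ENNReal.ofReal (2 * δ))⁻¹ *
    ENNReal.ofReal (2 * VectorCalculus.kineticEnergy (u 0)) with hA₀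
  have hA₀top : A₀ ≠ ∞ := ENNReal.mul_ne_top
    (ENNReal.inv_ne_top.2 (ENNReal.ofReal_pos.2 (by positivity)).ne') ENNReal.ofReal_ne_top
  set P₁ : ℝ≥0∞ := ∫⁻ w in Ioo (0 : ℝ) T ×ˢ (univ : Set (EuclideanSpace ℝ (Fin 3))), ‖q w.1 w.2‖ₑ ^ (3 / 2 : ℝ) with hP₁
  have hP₁top : P₁ ≠ ∞ := (hq32 T hT).ne
  set D₀ : ℝ≥0∞ := (ENNReal.ofReal (2 * δ) ^ 2)⁻¹ * P₁ with hD₀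
  have hD₀top : D₀ ≠ ∞ := ENNReal.mul_ne_top
    (ENNReal.inv_ne_top.2 (pow_ne_zero _ (ENNReal.ofReal_pos.2 (by positivity)).ne')) hP₁top
  -- ### Seregin's iteration, constants uniform in the centre
  obtain ⟨K, hKtop, hK⟩ := uniform_bound_of_interp hswQ hGQ hκtop hinterp hA₀top hD₀top
  -- ### weak-gradient identification `G = ∇u` a.e. on the strip `(0, T) × ℝ³`
  set Qs : Opens (ℝ × (EuclideanSpace ℝ (Fin 3))) := slab (EuclideanSpace ℝ (Fin 3)) (Ioo 0 T) isOpen_Ioo with hQsdef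
  have hQs : (Qs : Set (ℝ × (EuclideanSpace ℝ (Fin 3)))) = Ioo 0 T ×ˢ univ := rfl
  have hQsle : Qs ≤ slab (EuclideanSpace ℝ (Fin 3)) (Ioo 0 (T + 1)) isOpen_Ioo :=
    slab_mono (fun t ht => ⟨ht.1, by linarith [ht.2]⟩)
  have hGs : HasWeakSpatialGradientOn Qs v G := hGw.mono hQsle
  have hsm : ContDiffOn ℝ ((⊤ : ℕ∞) : WithTop ℕ∞) (uncurry u) (Ico 0 T ×ˢ (univ : Set (EuclideanSpace ℝ (Fin 3)))) :=
    hcl.smooth_velocity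
  have hC1 : ContDiffOn ℝ 1 (uncurry u) (Ioo 0 T ×ˢ (univ : Set (EuclideanSpace ℝ (Fin 3)))) :=
    (hsm.of_le (by exact_mod_cast le_top)).mono (Set.prod_mono Ioo_subset_Ico_self Subset.rfl)
  have hgu : HasWeakSpatialGradientOn Qs u (fun t x => fderiv ℝ (u t) x) :=
    hasWeakSpatialGradientOn_of_contDiffOn isOpen_Ioo (by rw [hQs]) hC1
  have hgv : HasWeakSpatialGradientOn Qs v (fun t x => fderiv ℝ (u t) x) := by
    refine hgu.congr_ae ?_
    rw [hQs]
    filter_upwards [hae] with w hw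
    exact hw.symm
  have hGae : ∀ᵐ w ∂(volume.restrict (Ioo 0 T ×ˢ (univ : Set (EuclideanSpace ℝ (Fin 3))))),
      uncurry G w = uncurry (fun t x => fderiv ℝ (u t) x) w := by
    have h := hGs.ae_eq hgv
    rwa [hQs] at h
  -- ### conclusion on the final slab `(T - δ², T) × ℝ³`
  refine ⟨T - δ ^ 2, by nlinarith, K, hKtop, fun r hr z hzr => ?_⟩
  obtain ⟨hm1, hm2⟩ := margins_of_subset_slab hr hzr
  have hrδ : r ≤ δ := (pow_le_pow_iff_left₀ hr.le hδ0.le two_ne_zero).1 (by nlinarith)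
  -- the starting ball `Q(z, 2δ)` lies in the rate slab
  have hsub₀ : parabolicCylinder (2 * δ) z ⊆ (Q : Set (ℝ × (EuclideanSpace ℝ (Fin 3)))) := by
    rw [hQ]
    intro w hw
    rw [mem_parabolicCylinder] at hw
    refine ⟨⟨?_, lt_of_lt_of_le hw.1.2 hm2⟩, mem_univ _⟩
    have : z.1 - (2 * δ) ^ 2 > t₂ := by
      rw [h2δsq, hd]; nlinarith
    linarith [hw.1.1]
  have hsubz : parabolicCylinder r z ⊆ Ioo 0 T ×ˢ (univ : Set (EuclideanSpace ℝ (Fin 3))) :=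
    hzr.trans (Set.prod_mono (Ioo_subset_Ioo_left (by nlinarith)) Subset.rfl)
  -- data at the starting ball
  have hA : cknAEss (2 * δ) z v ≤ A₀ := by
    rw [cknAEss_congr_ae (haeQ (hsub₀.trans (hQ ▸ hstrip₂)))]
    refine cknAEss_le_of_energy hLH zero_le_one fun t ht => ?_
    obtain ⟨hm1', hm2'⟩ := margins_of_subset_slab (by positivity : (0 : ℝ) < 2 * δ) (hQ ▸ hsub₀)
    exact ⟨ht₂0.trans (hm1'.trans ht.1.le), (ht.2.trans_le hm2').le⟩
  have hD : cknD (2 * δ) z q ≤ D₀ := by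
    rw [cknD, hD₀]
    exact mul_le_mul' le_rfl (lintegral_mono_set (hsub₀.trans (hQ ▸ hstrip₂)))
  have hKr := hK z (2 * δ) (by positivity) hsub₀ hA hD r ⟨hr, by linarith⟩
  -- transfer `v ↦ u`, `G ↦ ∇u`
  have hAu : cknAEss r z u = cknAEss r z v := (cknAEss_congr_ae (haeQ hsubz)).symm
  have hCu : cknC r z u = cknC r z v := (cknC_congr_ae (haeQ hsubz)).symm
  have hEu : cknE r z (fun s y => fderiv ℝ (u s) y) = cknE r z G := by
    unfold cknE
    congr 1
    refine lintegral_congr_ae ?_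
    filter_upwards [ae_restrict_of_ae_restrict_of_subset hsubz hGae] with w hw
    have hw' : G w.1 w.2 = fderiv ℝ (u w.1) w.2 := hw
    rw [hw']
  rw [hAu, hCu, hEu]
  refine ⟨?_, ?_, ?_⟩
  · exact (le_add_right (le_add_right (le_add_right le_rfl))).trans hKr
  · calc cknC r z v ≤ cknAEss r z v + cknE r z G + cknC r z v := le_add_left le_rfl
      _ ≤ cknAEss r z v + cknE r z G + cknC r z v + cknD r z q := le_add_right le_rfl
      _ ≤ K := hKr
  · calc cknE r z G ≤ cknAEss r z v + cknE r z G := le_add_left le_rfl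
      _ ≤ cknAEss r z v + cknE r z G + cknC r z v + cknD r z q :=
          le_add_right (le_add_right le_rfl)
      _ ≤ K := hKr

end Summit.NavierStokesRegularity.NavierStokesRegularity.Theorems.TypeIliouvilleNoTypeII.SlabNecessary

end
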